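import Literature.NumberTheory.LFunctions.MertensErrorTermsMeanValueRHThm2LargeX
import Literature.NumberTheory.LFunctions.MertensThirdErrorPositive
import HarnessLib

/-!
# RH-CONDITIONAL literature, proof layer — «nothing here bears on the truth of RH»
# Zhao 2025, Theorem 2, first clause AS PRINTED: `Θ = 1/2 (RH) ⟹ ∫₂^X E₃(x) dx > 0` for ALL `X > 2` — PROVED

Proof companion of `MertensErrorTermsMeanValueRH.lean` (T. Zhao, Res. Number Theory **11** (2025) 62 = arXiv:2411.18903
[bib: `Zhao2025MertensMean`]); theorems only, no definition, no named fact. The first conjunct of the named fact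
`Zhao2025MertensMean_thm2` reads `RiemannHypothesis → ∀ X > 2, 0 < ∫₂^X E₃` (`E₃(x) = (log x)⁻¹∏_{p≤x}(1 − 1/p)⁻¹ − e^γ`).
It is assembled here from

* `Zhao2025.integral_E₃_pos_of_RH_of_ge` (`MertensErrorTermsMeanValueRHThm2LargeX.lean`): under RH, `∫₂^X E₃ > 0` for
  every `X ≥ 358801` (explicit form of the source's §4 via the explicit Theorem 1 for `E₂`);
* `Zhao2025.E₃_pos_of_lt` (`MertensThirdErrorPositive.lean`): the RH-free kernel certificate `E₃(x) > 0` for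
  `2 ≤ x < 358811` (the tree's counterpart of the source's numerical input, Rosser–Schoenfeld Thm 23 up to `10⁸`).

`Zhao2025MertensMean_thm2_clause1` is the printed first clause. The second clause of the fact (the sign changes when
`1/2 < Θ < 1`) keeps its status: positive half proved (`Zhao2025.thm2_clause2_pos_of_not_RH`), negative half (the
source's second-moment Lemma 8) not formalized; the named fact is NOT discharged. RH-CONDITIONAL statement; nothing here
bears on the truth of RH. 0 sorry, standard axioms.
-/

noncomputable section

open MeasureTheory

namespace Literature.NumberTheory.LFunctions

namespace Zhao2025

/-- **Under RH, `∫₂^X E₃(x) dx > 0` for EVERY `X > 2`**: for `X ≥ 358801` by `integral_E₃_pos_of_RH_of_ge`, below by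
the kernel certificate `E₃ > 0` on `[2, 358811)` (`E₃_pos_of_lt`) integrated.
[cite: Zhao2025MertensMean, Thm 2 (Θ = 1/2)] -/
theorem integral_E₃_pos_of_RH (hRH : RiemannHypothesis) {X : ℝ} (hX : 2 < X) :
    0 < ∫ x in (2 : ℝ)..X, E₃ x := by
  rcases le_or_gt 358801 X with h | h
  · exact integral_E₃_pos_of_RH_of_ge hRH h
  · exact intervalIntegral.intervalIntegral_pos_of_pos_on (intervalIntegrable_E₃ le_rfl hX.le)
      (fun x hx => E₃_pos_of_lt hx.1.le (by linarith [hx.2])) hX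

end Zhao2025

/-- **Zhao 2025, Theorem 2, first clause, AS PRINTED, PROVED**: «if `Θ = 1/2` [RH] then `∫₂^X E₃(x) dx > 0` for all
`X > 2`» — the first conjunct of the named fact `Zhao2025MertensMean_thm2`, as a theorem of the tree. RH-CONDITIONAL;
nothing here bears on the truth of RH. [cite: Zhao2025MertensMean, Thm 2 (Θ = 1/2)] -/
theorem Zhao2025MertensMean_thm2_clause1 :
    RiemannHypothesis → ∀ X : ℝ, 2 < X → 0 < ∫ x in (2 : ℝ)..X, Zhao2025.E₃ x :=
  fun hRH _ hX => Zhao2025.integral_E₃_pos_of_RH hRH hX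

end Literature.NumberTheory.LFunctions

end
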